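import Mathlib
import HarnessLib
import Literature.AlgebraicGeometry.Resolution.BlowupChartRsop
import Literature.AlgebraicGeometry.Resolution.SymbolicPowersRsop
import Summits.ResolutionOfSingularities.ResolutionOfSingularities.Theorems.FrobeniusClosingSteerChartRsopPart

/-!
# The monoidal transform at the origin of the chart has dimension at least that of the base
# (Kollár–Szabó going down, (K2-centres-dim); crux `WildQuotients.WildQuotientResolution`, stub `stub_phaseZeroHighDim`)

Crux stmt-ResolutionOfSingularities-15640 (`WildQuotientResolution`), registered stub `stub_phaseZeroHighDim`;
programme PHASE0-KS-EIGENLINE, item (K2-centres-dim) of hand 8-g3's remaining list: for the CLOSEDNESS of the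
Kollár–Szabó fixed point `x'` on the blow-up along a regular stable centre (✓`KSCentreRegularFixedPoint`:
`𝒪_{X',x'} ≅ R₁ = S[J/t]_𝔫`) one needs `dim 𝒪_{X',x'} = dim 𝒪_{X,x}` (then ✓`IsBlowup.isClosed_singleton_of_ringKrullDim_eq`);
the upper bound is ✓`IsBlowup.ringKrullDim_stalk_le`. This file proves the LOWER bound at the ring level:

* `exists_append_of_injective` — bookkeeping: complete an injective `e : Fin m → Fin d` by an enumeration `w₀` of the
  complement of its range, `m + l = d`;
* ★ `le_ringKrullDim_ofPrime_closure_chart` — for `S ⊆ K` REGULAR local of embedding dimension `d` with regular system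
  of parameters `x`, `e : Fin (m+1) → Fin d` injective (centre coordinates `y = x ∘ e`, `y_i ≠ 0`), and a prime `𝔫` of
  the chart ring `S[J/y_i]` over `𝔪_S` containing ALL `y_j/y_i` (`j ≠ i`) — the origin —: **`d ≤ dim S[J/y_i]_𝔫`**.
  Proof: the tree's abstract-chart theorem ✓`isRsopPart_chartFamily` (de Jong 2.4 / Liu 8.1.19: `(y_i, (y_j/y_i)_{j≠i}, w)`
  is part of a regular system of parameters of the local ring of the chart at a prime over `𝔪`), fed with the chart
  datum of ✓`SwitchingDichotomy.ChartRsop.closure_chartQuotient_X` and `L = LocalSubring.ofPrime`; the family has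
  `1 + m + (d − m − 1) = d` members.

[OURS · crux stmt-ResolutionOfSingularities-15640 · helper toward `stub_phaseZeroHighDim` ((K2-centres-dim); NOT a proof of
the stub); folklore after [DeJong1996, 2.4], counted 0; AI-level work, weaker than expert review.] [folklore]
-/

-- single-problem summit: the doubled namespace component `ResolutionOfSingularities` is forced
set_option linter.dupNamespace false

noncomputable section

namespace Summit.ResolutionOfSingularities.ResolutionOfSingularities.Theorems.WildQuotientResolution.CentreChart

open IsLocalRing Literature.AlgebraicGeometry.Resolution
open Summit.ResolutionOfSingularities.ResolutionOfSingularities.Theorems.WildQuotientResolution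
open Summit.ResolutionOfSingularities.ResolutionOfSingularities.Theorems.SwitchingDichotomy.ChartRsop

universe u

/-- **Completing an injection of finite sets to a cover**: for `e : Fin m → Fin d` injective there are `l` with
`m + l = d` and `w₀ : Fin l → Fin d` such that every index is in the range of `e` or of `w₀`. [folklore] -/
theorem exists_append_of_injective {d m : ℕ} (e : Fin m → Fin d) (he : Function.Injective e) :
    ∃ (l : ℕ) (w₀ : Fin l → Fin d), m + l = d ∧ ∀ k : Fin d, (∃ j, e j = k) ∨ ∃ j, w₀ j = k := by
  classical
  let s : Finset (Fin d) := Finset.univ \ Finset.univ.image e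
  refine ⟨s.card, fun j => (s.equivFin.symm j : Fin d), ?_, fun k => ?_⟩
  · have h1 : (Finset.univ.image e).card = m := by
      rw [Finset.card_image_of_injective _ he, Finset.card_univ, Fintype.card_fin]
    have h2 : s.card = (Finset.univ : Finset (Fin d)).card - (Finset.univ.image e).card :=
      Finset.card_sdiff_of_subset (Finset.subset_univ _)
    rw [h2, h1, Finset.card_univ, Fintype.card_fin]
    have : m ≤ d := by
      have := Fintype.card_le_of_injective e he
      simpa using this
    omega
  · by_cases hk : k ∈ Finset.univ.image e
    · obtain ⟨j, -, hj⟩ := Finset.mem_image.mp hk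
      exact Or.inl ⟨j, hj⟩
    · have hks : k ∈ s := Finset.mem_sdiff.mpr ⟨Finset.mem_univ _, hk⟩
      exact Or.inr ⟨s.equivFin ⟨k, hks⟩, by simp⟩

variable {K : Type u} [Field K]

/-- **The monoidal transform at the origin of the chart has dimension `≥ dim S`.** Let `S ⊆ K` be a regular local
subring with regular system of parameters `x : Fin d → S` (`(x) = 𝔪`, `d` the embedding dimension),
`e : Fin (m+1) → Fin d` injective, `y = x ∘ e` (a regular centre `J = (y)`), `y_i ≠ 0`, and `𝔫` a prime of the chart
ring `S[J/y_i] = Subring.closure (S ∪ {y_j/y_i})` lying over `𝔪_S` and containing every `y_j/y_i`, `j ≠ i` (the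
ORIGIN of the chart, e.g. ✓`CentreChart.exists_centreChartOrigin`). Then `d ≤ dim S[J/y_i]_𝔫`: the `d` elements
`y_i, (y_j/y_i)_{j ≠ i}, (x_k)_{k ∉ range e}` are part of a regular system of parameters of `S[J/y_i]_𝔫`
(✓`isRsopPart_chartFamily`). With ✓`IsBlowup.ringKrullDim_stalk_le` this gives `dim 𝒪_{X',x'} = dim 𝒪_{X,x}` at the
Kollár–Szabó fixed point. [cite: DeJong1996, 2.4] [cite: Liu2002, Thm. 8.1.19] -/
theorem le_ringKrullDim_ofPrime_closure_chart (S : Subring K) [IsRegularLocalRing S] {d m : ℕ}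
    (hd : (maximalIdeal S).spanFinrank = d) (x : Fin d → S)
    (hx : Ideal.span (Set.range x) = maximalIdeal S) (e : Fin (m + 1) → Fin d) (he : Function.Injective e)
    (i : Fin (m + 1)) (hyi : x (e i) ≠ 0)
    (𝔫 : Ideal (Subring.closure ((S : Set K) ∪
      Set.range fun j : Fin (m + 1) => ((x (e j) : S) : K) / ((x (e i) : S) : K)))) [𝔫.IsPrime]
    (hover : ∀ s : S, (⟨(s : K), le_closure_chart S (x ∘ e) i s.2⟩ : Subring.closure ((S : Set K) ∪
      Set.range fun j : Fin (m + 1) => ((x (e j) : S) : K) / ((x (e i) : S) : K))) ∈ 𝔫 ↔ s ∈ maximalIdeal S)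
    (hnj : ∀ j : Fin (m + 1), j ≠ i →
      (⟨((x (e j) : S) : K) / ((x (e i) : S) : K), div_mem_closure_chart S (x ∘ e) i j⟩ :
        Subring.closure ((S : Set K) ∪
          Set.range fun j : Fin (m + 1) => ((x (e j) : S) : K) / ((x (e i) : S) : K))) ∈ 𝔫) :
    (d : WithBot ℕ∞) ≤ ringKrullDim (LocalSubring.ofPrime (Subring.closure ((S : Set K) ∪
      Set.range fun j : Fin (m + 1) => ((x (e j) : S) : K) / ((x (e i) : S) : K))) 𝔫).toSubring := by
  classical
  -- the centre coordinates and the chart ring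
  let y : Fin (m + 1) → S := x ∘ e
  let C : Subring K :=
    Subring.closure ((S : Set K) ∪ Set.range fun j : Fin (m + 1) => ((x (e j) : S) : K) / ((x (e i) : S) : K))
  have hSC : S ≤ C := le_closure_chart S y i
  haveI : IsNoetherianRing C := isNoetherianRing_closure_chart y i
  have h0 : ((y i : S) : K) ≠ 0 := fun h => hyi (Subtype.ext h)
  -- complete `e` by an enumeration `w₀` of the other coordinates
  obtain ⟨l, w₀, hml, hcover⟩ := exists_append_of_injective e he
  let w : Fin l → S := x ∘ w₀
  -- `(y, w)` is the regular system of parameters `x`, re-indexed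
  have hz : Ideal.span (Set.range (Fin.append y w)) = maximalIdeal S := by
    apply le_antisymm
    · rw [← hx]
      refine Ideal.span_mono ?_
      rintro _ ⟨k, rfl⟩
      induction k using Fin.addCases with
      | left j => exact ⟨e j, by rw [Fin.append_left]; rfl⟩
      | right j => exact ⟨w₀ j, by rw [Fin.append_right]; rfl⟩
    · rw [← hx]
      refine Ideal.span_le.mpr ?_
      rintro _ ⟨k, rfl⟩
      rcases hcover k with ⟨j, rfl⟩ | ⟨j, rfl⟩
      · exact Ideal.subset_span ⟨Fin.castAdd l j, by rw [Fin.append_left]; rfl⟩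
      · exact Ideal.subset_span ⟨Fin.natAdd (m + 1) j, by rw [Fin.append_right]; rfl⟩
  have hd' : (maximalIdeal S).spanFinrank = (m + 1) + l := by rw [hd, hml]
  -- `y` is quasi-regular; the chart quotient `C/(y_i) ≅ (S/J)[T_j : j ≠ i]` with the variables tracked
  have hqr : IsQuasiRegular y := isQuasiRegular_rsop_comp hd x hx e he
  obtain ⟨ψX, hψX, hψC, hψXX⟩ := closure_chartQuotient_X S y hqr i hyi
  have hnzd : Subring.inclusion hSC (y i) ∈ nonZeroDivisors C := by
    refine mem_nonZeroDivisors_of_ne_zero fun h => h0 ?_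
    exact congrArg Subtype.val h
  -- the origin prime lies over `𝔪_S`
  have h𝔓 : 𝔫.comap (Subring.inclusion hSC) = maximalIdeal S := by
    ext s
    rw [Ideal.mem_comap]
    exact hover s
  -- all the fractions `y_j/y_i`, `j ≠ i`, lie in `𝔫`
  let jJ : Fin m → {j : Fin (m + 1) // j ≠ i} := fun k => ⟨i.succAbove k, Fin.succAbove_ne i k⟩
  have hjJ : Function.Injective jJ := fun a b h =>
    Fin.succAbove_right_injective (congrArg Subtype.val h)
  have hJ : ∀ k, (fun j : Fin (m + 1) => (⟨((y j : S) : K) / ((y i : S) : K), div_mem_closure_chart S y i j⟩ : C))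
      (jJ k).1 ∈ 𝔫 := fun k => hnj _ (Fin.succAbove_ne i k)
  -- the abstract chart theorem: the chart family is part of a regular system of parameters of `C_𝔫`
  have hpart := isRsopPart_chartFamily y i w hz hd' (LocalSubring.ofPrime C 𝔫).toSubring (Subring.inclusion hSC)
    (fun j => ⟨((y j : S) : K) / ((y i : S) : K), div_mem_closure_chart S y i j⟩) hnzd
    (RingEquiv.ofBijective ψX hψX) (fun s => hψC s) (fun j => hψXX j) 𝔫 h𝔓 jJ hjJ hJ
  obtain ⟨-, e', -, hdim, -⟩ := hpart
  rw [hdim, ← hml]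
  exact_mod_cast (by omega : m + 1 + l ≤ m + l + 1 + e')

end Summit.ResolutionOfSingularities.ResolutionOfSingularities.Theorems.WildQuotientResolution.CentreChart

end
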